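import Summits.CriticalPhenomena.PercolationContinuityZ3.Theorems.PercNearOneGluingNoHeavyQuantOneArmTwoOfTwoPoint
import Literature.Barriers.CriticalPhenomena.LaceExpansionEtaZeroXSpaceEventually
import Literature.Barriers.CriticalPhenomena.LaceExpansionHighDimensionTriangleHolds
import HarnessLib

/-!
# (T1) with the SHARP exponent `2` — UNCONDITIONAL in all sufficiently high dimensions

PAPER-2 track (i), ARM-3 (the power-law landmark; "mean-field bound transfer for `d > 6`"), gen 6.
builds on p205010 (kernel theorem, internal audit signed; external expert review pending).

Up to gen 5 the lane's sharp high-dimensional row was CONDITIONAL on the two-point estimate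
`TwoPointBoundedRatio d` (`…QuantOneArmTwoOfTwoPoint.lean`: Kozma–Nachmias 2011 proved from it in
full), and the only UNCONDITIONAL kernel power law in dimension `≥ 3` had exponent `1/2`
(`Quant.oneArmPolyDecay_of_ten_pow_fifty_le`, `Quant.oneArmPolyDecay_eventually`, from the kernel
Hara–Slade triangle condition).  The two-point estimate itself is now a theorem of the tree for all
sufficiently large `d` (`Literature.Barriers.CriticalPhenomena.twoPointBoundedRatio_eventually`,
`LaceExpansionEtaZeroXSpaceEventually.lean`: Hara 2008, Thm. 1.1 — `x`-space asymptotics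
`τ_{p_c}(x) = A₂|x|^{2−d}(1 + O(|x|^{−2/d}))` — assembled from the proved bootstrap of
Heydenreich–van der Hofstad Prop. 8.8, Hara's framework §1.2, the Gaussian lemma, Lemmas 1.5–1.7 and
the two-long-lines estimate §3.5, every step a kernel theorem).  This file records the lane rows:

* `Quant.oneArmPolyDecayAtCritical_two_eventually` — **`∃ D > 6, ∀ d ≥ D, ∃ C, OneArmPolyDecayAtCritical d 2 C`**,
  UNCONDITIONAL (standard axioms, no named fact): the mean-field one-arm law `π_{p_c}(n) ≤ C n^{−2}`;
* `Quant.oneArm_two_sided_eventually` — both bounds `c n^{−2} ≤ π_{p_c}(n) ≤ C n^{−2}` (Kozma–Nachmias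
  2011, Thm. 1; `Literature.Barriers.CriticalPhenomena.rhoExHalf_eventually`) in the lane's vocabulary;
* `Quant.oneArmPolyDecayAtCritical_exponent_le_two_of_rhoExHalf`, `…_exponent_le_two_eventually` — for
  `d ≥ D` every instance `OneArmPolyDecayAtCritical d c C` has `c ≤ 2`: the exponent `2` is ATTAINED AND
  EXTREMAL (compare with `…_exponent_le_third`: `c ≤ d/3` in every dimension, `= 2` only at `d = 6`);
* `Quant.meanFieldArmRows_eventually` — the complete high-dimensional row of the (T1)/(T2) table,
  unconditionally: Hölder exponent `1` with `C > 0` (triangle condition, Barsky–Aizenman), one-arm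
  exponent `2` attained, and `2` maximal.  (The existential `OneArmPolyDecay d` row for large `d` is the
  tree's `Quant.oneArmPolyDecay_eventually`, not restated.)

Honest reading: REPRODUCTION of published theorems (Hara–Slade 1990, Hara 2008, Kozma–Nachmias 2011),
kernel-checked end to end with an existential, un-optimised dimension threshold `D` (the printed ranges
are `d ≥ 19` for Hara/Kozma–Nachmias and `d ≥ 11` with Fitzner–van der Hofstad's computer-assisted
bounds, which stay named facts for `11 ≤ d < D`); NOTHING here bears on `3 ≤ d ≤ 6`, where exponent `2`
is excluded for `d ≤ 5` and the power law itself is the open landmark.  What changes for the paper's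
Remark rem:ceil-highd: "for `d > 6` under the two-sided two-point bound" can be followed by "and
unconditionally for all sufficiently large `d`".
-/

noncomputable section

namespace Summit.CriticalPhenomena.PercolationContinuityZ3.Theorems.Quant

open Filter Topology Literature.Probability.LatticeModels Literature.Probability.Percolation
  Literature.Barriers.CriticalPhenomena

variable {d : ℕ}

/-- **(T1) with the sharp exponent `2`, UNCONDITIONAL for all sufficiently large `d`**:
`∃ D > 6, ∀ d ≥ D, ∃ C, OneArmPolyDecayAtCritical d 2 C`, i.e. `π_{p_c(ℤ^d)}(n) ≤ C n^{−2}` for all `n ≥ 1`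
— Kozma–Nachmias 2011, Thm. 1 (upper bound), the two-point input being the tree's
`twoPointBoundedRatio_eventually` (Hara–Slade 1990 + Hara 2008, proved).  Standard axioms, no named fact.
[cite: KozmaNachmias2011, Thm. 1] [cite: Hara2008, Thm. 1.1] [cite: HaraSlade1990, Thm. 1.1] -/
theorem oneArmPolyDecayAtCritical_two_eventually :
    ∃ D : ℕ, 6 < D ∧ ∀ d : ℕ, D ≤ d → ∃ C : ℝ, OneArmPolyDecayAtCritical d 2 C := by
  obtain ⟨D, hD, h⟩ := twoPointBoundedRatio_eventually
  exact ⟨D, hD, fun d hd =>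
    oneArmPolyDecayAtCritical_two_of_twoPointBoundedRatio (lt_of_lt_of_le hD hd) (h d hd)⟩

/-- **Both mean-field one-arm bounds, UNCONDITIONAL for all sufficiently large `d`** (Kozma–Nachmias 2011,
Thm. 1; Heydenreich–van der Hofstad 2017, (11.3.2) "`ρ_ex = 1/2`"): `∃ D > 6, ∀ d ≥ D, ∃ c > 0, ∃ C`, for all
`n ≥ 1`, `c n^{−2} ≤ P_{p_c}(0 ↔ ∂B(n)) ≤ C n^{−2}` — the tree's `rhoExHalf_eventually` in the lane's
vocabulary (`(bondPercolation (zdGraph d) p_c).real (siteToBoundary d n) = oneArmProb d p_c n` by `rfl`).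
[cite: KozmaNachmias2011, Thm. 1] [cite: HeydenreichVanDerHofstad2017, Thm. 11.5 (11.3.2)] -/
theorem oneArm_two_sided_eventually :
    ∃ D : ℕ, 6 < D ∧ ∀ d : ℕ, D ≤ d → ∃ c C : ℝ, 0 < c ∧ ∀ n : ℕ, 1 ≤ n →
      c * (n : ℝ) ^ (-(2 : ℝ)) ≤ (bondPercolation (zdGraph d) (criticalProbI d)).real (siteToBoundary d n) ∧
        (bondPercolation (zdGraph d) (criticalProbI d)).real (siteToBoundary d n) ≤ C * (n : ℝ) ^ (-(2 : ℝ)) := by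
  obtain ⟨D, hD, h⟩ := rhoExHalf_eventually
  refine ⟨D, hD, fun d hd => ?_⟩
  obtain ⟨c, C, hc, hcC⟩ := h d hd
  refine ⟨c, C, hc, fun n hn => ?_⟩
  have hn0 : (0 : ℝ) < n := by exact_mod_cast hn
  have hrw : (n : ℝ) ^ (-(2 : ℝ)) = ((n : ℝ) ^ 2)⁻¹ := by rw [Real.rpow_neg hn0.le, Real.rpow_two]
  obtain ⟨hlo, hhi⟩ := hcC n hn
  constructor
  · calc c * (n : ℝ) ^ (-(2 : ℝ)) = c / (n : ℝ) ^ 2 := by rw [hrw, div_eq_mul_inv]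
      _ ≤ oneArmProb d (criticalProbI d) n := hlo
      _ = (bondPercolation (zdGraph d) (criticalProbI d)).real (siteToBoundary d n) := rfl
  · calc (bondPercolation (zdGraph d) (criticalProbI d)).real (siteToBoundary d n)
        = oneArmProb d (criticalProbI d) n := rfl
      _ ≤ C / (n : ℝ) ^ 2 := hhi
      _ = C * (n : ℝ) ^ (-(2 : ℝ)) := by rw [hrw, div_eq_mul_inv]

/-- **Exponent `2` is extremal wherever `ρ_ex = 1/2` holds**: `RhoExHalf d` and `OneArmPolyDecayAtCritical d c C`
force `c ≤ 2` (compare `C m^{−c}` with the lower bound `c₀ m^{−2}` as `m → ∞`; the mechanism of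
`oneArmPolyDecayAtCritical_exponent_le` with Kozma–Nachmias's floor in place of the `(d−1)/2` floor).
[cite: KozmaNachmias2011, Thm. 1 (lower bound) and Lemma 1.1] -/
theorem oneArmPolyDecayAtCritical_exponent_le_two_of_rhoExHalf (hρ : RhoExHalf d) {c C : ℝ}
    (h : OneArmPolyDecayAtCritical d c C) : c ≤ 2 := by
  by_contra hc
  push Not at hc
  obtain ⟨K, C', hK0, hK⟩ := hρ
  have hce : 0 < c - 2 := by linarith
  -- `C m^{-(c-2)} → 0`
  have htend : Tendsto (fun x : ℝ => C * x ^ (-(c - 2))) atTop (𝓝 0) := by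
    have := (tendsto_rpow_neg_atTop hce).const_mul C
    simpa using this
  have hev : ∀ᶠ m : ℕ in atTop, C * (m : ℝ) ^ (-(c - 2)) < K :=
    (htend.comp tendsto_natCast_atTop_atTop).eventually (gt_mem_nhds hK0)
  obtain ⟨m, hmK, hm1⟩ := (hev.and (eventually_ge_atTop 1)).exists
  have hm0 : (0 : ℝ) < m := by exact_mod_cast hm1
  have hfloor : K / (m : ℝ) ^ 2 ≤ oneArmProb d (criticalProbI d) m := (hK m hm1).1
  have hup : oneArmProb d (criticalProbI d) m ≤ C * (m : ℝ) ^ (-c) := h m hm1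
  have hchain : K / (m : ℝ) ^ 2 ≤ C * (m : ℝ) ^ (-c) := hfloor.trans hup
  -- multiply by `m² > 0`
  have hm2 : 0 < (m : ℝ) ^ (2 : ℝ) := Real.rpow_pos_of_pos hm0 2
  have h1 : K / (m : ℝ) ^ 2 * (m : ℝ) ^ (2 : ℝ) = K := by
    rw [Real.rpow_two]; field_simp
  have h2 : C * (m : ℝ) ^ (-c) * (m : ℝ) ^ (2 : ℝ) = C * (m : ℝ) ^ (-(c - 2)) := by
    rw [mul_assoc, ← Real.rpow_add hm0]; ring_nf
  have h3 : K ≤ C * (m : ℝ) ^ (-(c - 2)) := by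
    rw [← h1, ← h2]; exact mul_le_mul_of_nonneg_right hchain hm2.le
  linarith

/-- **For all sufficiently large `d` the one-arm exponent `2` is EXTREMAL among the lane's (T1) instances**:
`∃ D > 6, ∀ d ≥ D, ∀ c C, OneArmPolyDecayAtCritical d c C → c ≤ 2` — unconditional (the lower bound of
`rhoExHalf_eventually`).  In every dimension `c ≤ d/3` (`…_exponent_le_third`); here the sharp value.
[cite: KozmaNachmias2011, Thm. 1] [cite: DewanMuirhead2022, Thm. 1.1] -/
theorem oneArmPolyDecayAtCritical_exponent_le_two_eventually :
    ∃ D : ℕ, 6 < D ∧ ∀ d : ℕ, D ≤ d → ∀ c C : ℝ, OneArmPolyDecayAtCritical d c C → c ≤ 2 := by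
  obtain ⟨D, hD, h⟩ := rhoExHalf_eventually
  exact ⟨D, hD, fun d hd c C hcC => oneArmPolyDecayAtCritical_exponent_le_two_of_rhoExHalf (h d hd) hcC⟩

/-- **The complete mean-field row of the lane's (T1)/(T2) table, UNCONDITIONAL for all sufficiently large `d`**:
`∃ D > 6` such that for every `d ≥ D`
(i) `∃ C > 0, ThetaHolderNearCritical d 1 C` (`θ(p) ≤ C(p − p_c)`, Barsky–Aizenman under the kernel Hara–Slade
triangle condition — the sharp (T2) exponent `β = 1`),
(ii) `∃ C, OneArmPolyDecayAtCritical d 2 C` (Kozma–Nachmias, the sharp (T1) exponent `1/ρ = 2`), and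
(iii) every (T1) instance has exponent `≤ 2`.  Standard axioms; no named fact; bookkeeping over the tree's
`HaraSlade1990_triangleCondition_holds`, `twoPointBoundedRatio_eventually`, `rhoExHalf_eventually`.
[cite: HaraSlade1990, Thm. 1.1] [cite: HeydenreichVanDerHofstad2017, Thm. 4.1 and Thm. 11.5] [cite: KozmaNachmias2011, Thm. 1] -/
theorem meanFieldArmRows_eventually :
    ∃ D : ℕ, 6 < D ∧ ∀ d : ℕ, D ≤ d →
      (∃ C : ℝ, 0 < C ∧ ThetaHolderNearCritical d 1 C) ∧
      (∃ C : ℝ, OneArmPolyDecayAtCritical d 2 C) ∧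
      (∀ c C : ℝ, OneArmPolyDecayAtCritical d c C → c ≤ 2) := by
  obtain ⟨D₁, hD₁, h₁⟩ := HaraSlade1990_triangleCondition_holds
  obtain ⟨D₂, hD₂, h₂⟩ := oneArmPolyDecayAtCritical_two_eventually
  obtain ⟨D₃, -, h₃⟩ := oneArmPolyDecayAtCritical_exponent_le_two_eventually
  refine ⟨max (max D₁ D₂) D₃, lt_of_lt_of_le hD₁ (le_trans (le_max_left _ _) (le_max_left _ _)),
    fun d hd => ⟨?_, ?_, ?_⟩⟩
  · have hd₁ : D₁ ≤ d := le_trans (le_max_left _ _) (le_trans (le_max_left _ _) hd)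
    exact thetaHolderNearCritical_one_of_triangle (by omega) (h₁ d hd₁)
  · exact h₂ d (le_trans (le_max_right _ _) (le_trans (le_max_left _ _) hd))
  · exact h₃ d (le_trans (le_max_right _ _) hd)

end Summit.CriticalPhenomena.PercolationContinuityZ3.Theorems.Quant

end
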